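import Mathlib
import HarnessLib
import Summits.ValiantsHypothesis.ValiantsHypothesis.Theorems.EquivariantDialLayers

/-!
# Equivariant-dc dial, LAYERED notch (2/3): Valiant's construction «layered program ↦ determinant» in
# Cramer form — the graph, `det (1 - Adj) = 1`, the path lemma, Valiant's matrix and its level blocks
# (decomp-valiant workshop, lens 1, generation 14) — support file; NOT a route

HONEST FRAMING.  `VP ≠ VNP` is NOT proved here; this is the second of three sorry-free SUPPORT files of the
census cell `A = EquivariantDialNode.EqHardBiPerm` (item `stmt-ValiantsHypothesis-23702`, supported, not
closed); see `EquivariantDialLayers` (1/3: the model, the equivariant Nisan cut lemma, the cell `A^lay`) and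
`EquivariantDialLayersLifts` (3/3: the block-diagonal lifts, the bridge theorem and the kernels `A ⟹ A^lay`).

## What is proved

For a layered program `P : LayeredABP σ k L w` (`w ≥ 1`), Valiant's layered digraph on
`Vtx L w = Fin w × Fin (L + 3)` (level `0`: source; levels `1 … L+1`: the program's vertex layers; level
`L + 2`: sink) with weighted adjacency matrix `adj` [Valiant1979], [Burgisser2000, §2.3], [MalodPortier2008]:
* `adj_pow_apply_of_ne` / `adj_pow_eq_zero` (level bookkeeping, nilpotency), `det_one_sub_adj`
  (`det (1 - Adj) = 1`, block-unitriangular), `adjugate_one_sub_adj` (`adjugate (1 - Adj) = Σ_{n ≤ L+2} Adjⁿ`),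
  the path lemma `adj_pow_apply_level_zero` and `prod_map_blk_apply_zero`, whence
  `adjugate_one_sub_adj_vs_vt : adjugate (1 - Adj) s t = P.eval`;
* **Valiant's matrix in Cramer form** `vmat := (1 - Adj).updateRow t e_s` with `det_vmat : det vmat = P.eval`
  (Mathlib `Matrix.adjugate_apply`; no minors, no signs) and affine entries (`isAffineDetRepr_vmat`, any
  reindexing `Vtx L w ≃ Fin N`);
* the LEVEL-BLOCK calculus used by the lifts: `blockDiagonal_mul_apply`, `mul_blockDiagonal_apply`, the blocks
  `vblk` of Valiant's matrix (`vmat_submatrix_level`), reindexed units `glReindex`, and the width-`0` /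
  zero-polynomial corner cases.
-/

set_option linter.dupNamespace false

namespace Summit.ValiantsHypothesis.ValiantsHypothesis.Theorems.EquivariantDialLayers

open MvPolynomial Matrix Literature.Computability.AlgebraicComplexity
open Summit.ValiantsHypothesis.ValiantsHypothesis.Theorems.EquivariantDialNode
open Summit.ValiantsHypothesis.ValiantsHypothesis.Theorems.EquivariantDialGrading

noncomputable section

section Valiant

variable {σ : Type*} {k : Type*} [CommRing k] {L w : ℕ}

namespace LayeredABP

/-- Vertices of Valiant's graph: `w` slots on each of `L + 3` levels (level `0`: the source, slot `0`;
levels `1 … L+1`: the program's vertex layers `0 … L`; level `L + 2`: the sink, slot `0`; the other slots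
of the two end levels are isolated vertices). -/
abbrev Vtx (L w : ℕ) : Type := Fin w × Fin (L + 3)

variable (P : LayeredABP σ k L w)

section Graph

variable [NeZero w]

/-- Source block (level `0 →` level `1`): the source is joined to vertex `j` of layer `0` with weight `u j`. -/
def srcK : Matrix (Fin w) (Fin w) k := Matrix.of fun i j => if i = 0 then P.u j else 0

/-- Sink block (level `L+1 →` level `L+2`): vertex `i` of layer `L` is joined to the sink with weight `v i`. -/
def snkK : Matrix (Fin w) (Fin w) k := Matrix.of fun i j => if j = 0 then P.v i else 0

/-- The block of edge weights from level `a` to level `a + 1`. -/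
def blk (a : ℕ) : Matrix (Fin w) (Fin w) (MvPolynomial σ k) :=
  if a = 0 then P.srcK.map C else if h : a - 1 < L then P.T ⟨a - 1, h⟩ else P.snkK.map C

/-- Block `0` is the source block. -/
theorem blk_zero : P.blk 0 = P.srcK.map C := by simp [blk]

/-- Blocks `1 … L` are the program's transition matrices. -/
theorem blk_succ (t : Fin L) : P.blk (t.val + 1) = P.T t := by
  rw [blk, if_neg (Nat.succ_ne_zero _), dif_pos (by simp)]
  simp

/-- Block `L + 1` is the sink block. -/
theorem blk_last : P.blk (L + 1) = P.snkK.map C := by simp [blk]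

/-- Block entries are affine. -/
theorem totalDegree_blk_le (a : ℕ) (i j : Fin w) : (P.blk a i j).totalDegree ≤ 1 := by
  unfold blk
  split_ifs
  · simp [Matrix.map_apply]
  · exact (P.linear _ i j).totalDegree_le
  · simp [Matrix.map_apply]

/-- The weighted adjacency matrix of Valiant's layered digraph. -/
def adj : Matrix (Vtx L w) (Vtx L w) (MvPolynomial σ k) :=
  Matrix.of fun p q => if p.2.val + 1 = q.2.val then P.blk p.2.val p.1 q.1 else 0

/-- Entries of the adjacency matrix. -/
theorem adj_apply (p q : Vtx L w) :
    P.adj p q = if p.2.val + 1 = q.2.val then P.blk p.2.val p.1 q.1 else 0 := rfl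

/-- Level bookkeeping: a path of length `n` raises the level by exactly `n`. -/
theorem adj_pow_apply_of_ne (n : ℕ) :
    ∀ p q : Vtx L w, p.2.val + n ≠ q.2.val → (P.adj ^ n) p q = 0 := by
  induction n with
  | zero =>
    intro p q h
    rw [pow_zero, Matrix.one_apply_ne]
    rintro rfl
    simp at h
  | succ n ih =>
    intro p q h
    rw [pow_succ, Matrix.mul_apply]
    refine Finset.sum_eq_zero fun r _ => ?_
    by_cases hr : p.2.val + n = r.2.val
    · rw [adj_apply, if_neg, mul_zero]
      omega
    · rw [ih p r hr, zero_mul]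

/-- The adjacency matrix is nilpotent. -/
theorem adj_pow_eq_zero : P.adj ^ (L + 3) = 0 :=
  Matrix.ext fun p q => P.adj_pow_apply_of_ne (L + 3) p q (by have := q.2.isLt; omega)

/-- `1 - Adj` is block upper-unitriangular for the level, hence `det (1 - Adj) = 1`. -/
theorem det_one_sub_adj : (1 - P.adj).det = 1 := by
  have hzero : ∀ p q : Vtx L w, q.2.val ≤ p.2.val → P.adj p q = 0 := by
    intro p q hle
    rw [adj_apply, if_neg]
    omega
  have hT : (1 - P.adj).BlockTriangular Prod.snd := by
    intro p q hlt
    have hne : p ≠ q := by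
      rintro rfl
      exact lt_irrefl _ hlt
    rw [Matrix.sub_apply, Matrix.one_apply_ne hne, hzero p q (Fin.le_def.mp hlt.le), sub_zero]
  rw [hT.det]
  refine Finset.prod_eq_one fun c _ => ?_
  rw [show (1 - P.adj).toSquareBlock Prod.snd c = 1 from ?_, Matrix.det_one]
  ext ⟨p, hp⟩ ⟨q, hq⟩
  have hc : q.2.val ≤ p.2.val := by
    have h : p.2 = q.2 := hp.trans hq.symm
    rw [h]
  rw [Matrix.toSquareBlock_def, Matrix.of_apply, Matrix.sub_apply, hzero p q hc, sub_zero, Matrix.one_apply,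
    Matrix.one_apply]
  simp only [Subtype.mk.injEq]

/-- The adjugate of `1 - Adj` is the finite geometric series `Σ_{n ≤ L+2} Adjⁿ` (the matrix of path sums). -/
theorem adjugate_one_sub_adj : (1 - P.adj).adjugate = ∑ n ∈ Finset.range (L + 3), P.adj ^ n := by
  have hmul : (1 - P.adj) * ∑ n ∈ Finset.range (L + 3), P.adj ^ n = 1 := by
    rw [mul_neg_geom_sum, adj_pow_eq_zero, sub_zero]
  have hinv := Matrix.inv_eq_right_inv hmul
  rwa [Matrix.inv_def, det_one_sub_adj, Ring.inverse_one, one_smul] at hinv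

/-- Paths from level `0`: `(Adjⁿ)_{(i,0),(j,n)}` is the `(i, j)` entry of the product of the first `n` blocks. -/
theorem adj_pow_apply_level_zero (n : ℕ) (hn : n ≤ L + 2) (i j : Fin w) :
    (P.adj ^ n) (i, ⟨0, by omega⟩) (j, ⟨n, by omega⟩) = ((List.range n).map P.blk).prod i j := by
  induction n generalizing j with
  | zero =>
    rw [List.range_zero, List.map_nil, List.prod_nil, pow_zero, Matrix.one_apply, Matrix.one_apply]
    simp only [Prod.mk.injEq, and_true]
  | succ n ih =>
    rw [pow_succ, Matrix.mul_apply, List.range_succ, List.map_append, List.map_singleton, List.prod_append,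
      List.prod_singleton, Matrix.mul_apply, Fintype.sum_prod_type]
    refine Finset.sum_congr rfl fun l _ => ?_
    rw [Finset.sum_eq_single ⟨n, by omega⟩]
    · rw [ih (by omega) l, adj_apply, if_pos rfl]
    · intro c _ hc
      rw [adj_apply, if_neg, mul_zero]
      intro h
      apply hc
      exact Fin.ext (by simpa using h)
    · intro h
      exact absurd (Finset.mem_univ _) h

/-- The product of all `L + 2` blocks is `(source block) · T 0 ⋯ T (L-1) · (sink block)`. -/
theorem prod_map_blk : ((List.range (L + 2)).map P.blk).prod = P.srcK.map C * P.prodT * P.snkK.map C := by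
  have h1 : (List.range (L + 2)).map P.blk =
      P.blk 0 :: ((List.range L).map (fun c => P.blk (c + 1)) ++ [P.blk (L + 1)]) := by
    rw [List.range_succ, List.map_append, List.map_singleton, List.range_succ_eq_map, List.map_cons,
      List.map_map]
    rfl
  have h2 : (List.range L).map (fun c => P.blk (c + 1)) = List.ofFn P.T := by
    apply List.ext_getElem
    · simp
    · intro n h₁ h₂
      rw [List.getElem_map, List.getElem_range, List.getElem_ofFn]
      exact P.blk_succ ⟨n, by simpa using h₂⟩
  rw [h1, List.prod_cons, List.prod_append, List.prod_singleton, h2, blk_zero, blk_last, prodT, Matrix.mul_assoc]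

/-- … and its `(0, 0)` entry is the computed polynomial. -/
theorem prod_map_blk_apply_zero : ((List.range (L + 2)).map P.blk).prod 0 0 = P.eval := by
  rw [prod_map_blk, eval, Matrix.mul_assoc, Matrix.mul_apply, dotProduct]
  refine Finset.sum_congr rfl fun j _ => ?_
  rw [Matrix.map_apply, srcK, Matrix.of_apply, if_pos rfl, Matrix.mul_apply, Matrix.mulVec, dotProduct]
  refine congrArg _ (Finset.sum_congr rfl fun i _ => ?_)
  rw [Matrix.map_apply, snkK, Matrix.of_apply, if_pos rfl]

/-- The source vertex. -/
def vs (L w : ℕ) [NeZero w] : Vtx L w := (0, ⟨0, by omega⟩)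

/-- The sink vertex. -/
def vt (L w : ℕ) [NeZero w] : Vtx L w := (0, ⟨L + 2, by omega⟩)

/-- **Path sum = computed polynomial**: the `(source, sink)` entry of `adjugate (1 - Adj)`. -/
theorem adjugate_one_sub_adj_vs_vt : (1 - P.adj).adjugate (vs L w) (vt L w) = P.eval := by
  rw [adjugate_one_sub_adj, Matrix.sum_apply, Finset.sum_eq_single_of_mem (L + 2) (by simp) ?_]
  · exact (P.adj_pow_apply_level_zero (L + 2) le_rfl 0 0).trans P.prod_map_blk_apply_zero
  · intro n _ hne
    exact P.adj_pow_apply_of_ne n _ _ (by simp [vs, vt]; omega)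

/-- **Valiant's matrix** (Cramer form): `1 - Adj` with the sink row replaced by the unit vector of the
source.  Its determinant is the computed polynomial and its entries are affine. -/
def vmat : Matrix (Vtx L w) (Vtx L w) (MvPolynomial σ k) :=
  (1 - P.adj).updateRow (vt L w) (Pi.single (vs L w) 1)

/-- **`det V = f`.** -/
theorem det_vmat : P.vmat.det = P.eval := by
  rw [vmat, ← Matrix.adjugate_apply, adjugate_one_sub_adj_vs_vt]

/-- The entries of Valiant's matrix are affine. -/
theorem totalDegree_vmat_le (p q : Vtx L w) : (P.vmat p q).totalDegree ≤ 1 := by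
  rw [vmat, Matrix.updateRow_apply]
  split_ifs with h
  · rw [Pi.single_apply]
    split_ifs <;> simp
  · rw [Matrix.sub_apply]
    refine (totalDegree_sub _ _).trans (max_le ?_ ?_)
    · rw [Matrix.one_apply]
      split_ifs <;> simp
    · rw [adj_apply]
      split_ifs
      · exact P.totalDegree_blk_le _ _ _
      · simp

/-- Valiant's matrix is an affine determinantal representation of the computed polynomial (any reindexing). -/
theorem isAffineDetRepr_vmat {N : ℕ} (e : Vtx L w ≃ Fin N) :
    IsAffineDetRepr P.eval (P.vmat.submatrix e.symm e.symm) :=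
  ⟨fun p q => P.totalDegree_vmat_le _ _, by rw [Matrix.det_submatrix_equiv_self, det_vmat]⟩

/-! ### The level blocks of Valiant's matrix -/

omit [NeZero w] in
/-- Entries of `blockDiagonal D * A`, blockwise. -/
theorem blockDiagonal_mul_apply {α : Type*} [CommRing α] (D : Fin (L + 3) → Matrix (Fin w) (Fin w) α)
    (A : Matrix (Vtx L w) (Vtx L w) α) (i j : Fin w) (a b : Fin (L + 3)) :
    (Matrix.blockDiagonal D * A) (i, a) (j, b) =
      (D a * A.submatrix (fun l => (l, a)) (fun l => (l, b))) i j := by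
  simp only [Matrix.mul_apply, Fintype.sum_prod_type, Matrix.blockDiagonal_apply, Matrix.submatrix_apply,
    ite_mul, zero_mul, Finset.sum_ite_eq, Finset.mem_univ, if_true]

omit [NeZero w] in
/-- Entries of `A * blockDiagonal D`, blockwise. -/
theorem mul_blockDiagonal_apply {α : Type*} [CommRing α] (A : Matrix (Vtx L w) (Vtx L w) α)
    (D : Fin (L + 3) → Matrix (Fin w) (Fin w) α) (i j : Fin w) (a b : Fin (L + 3)) :
    (A * Matrix.blockDiagonal D) (i, a) (j, b) =
      (A.submatrix (fun l => (l, a)) (fun l => (l, b)) * D b) i j := by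
  simp only [Matrix.mul_apply, Fintype.sum_prod_type, Matrix.blockDiagonal_apply, Matrix.submatrix_apply,
    mul_ite, mul_zero, Finset.sum_ite_eq', Finset.mem_univ, if_true]

/-- The unit matrix `E₀₀` (sink row meets source column). -/
def e00 (w : ℕ) [NeZero w] : Matrix (Fin w) (Fin w) k := Matrix.of fun i j => if i = 0 ∧ j = 0 then 1 else 0

/-- The identity on the isolated slots of the sink level. -/
def isoK (w : ℕ) [NeZero w] : Matrix (Fin w) (Fin w) k := Matrix.diagonal fun i => if i = 0 then 0 else 1

/-- The blocks of Valiant's matrix. -/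
def vblk (a b : Fin (L + 3)) : Matrix (Fin w) (Fin w) (MvPolynomial σ k) :=
  if a.val = L + 2 then
    (if b.val = 0 then (e00 w : Matrix (Fin w) (Fin w) k).map C
      else if b.val = L + 2 then (isoK w : Matrix (Fin w) (Fin w) k).map C else 0)
  else (if a = b then 1 else 0) - (if a.val + 1 = b.val then P.blk a.val else 0)

/-- The blocks of Valiant's matrix are as stated. -/
theorem vmat_submatrix_level (a b : Fin (L + 3)) :
    P.vmat.submatrix (fun l => (l, a)) (fun l => (l, b)) = P.vblk a b := by
  obtain ⟨a, ha⟩ := a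
  obtain ⟨b, hb⟩ := b
  refine Matrix.ext fun i j => ?_
  simp only [Matrix.submatrix_apply, vmat, Matrix.updateRow_apply, vt, vs, vblk, Matrix.sub_apply, adj_apply,
    Matrix.one_apply, Pi.single_apply, Prod.mk.injEq, Fin.mk.injEq, e00, isoK]
  split_ifs <;> simp_all [Matrix.diagonal]

end Graph

section Aux

variable [Fintype σ] [DecidableEq σ] {γ : GL σ k}

/-- Substitution of variables fixes the zero matrix. -/
theorem linSubstEntries_zero_aux :
    Matrix.linSubstEntries γ (0 : Matrix (Fin w) (Fin w) (MvPolynomial σ k)) = 0 :=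
  Matrix.map_zero _ (map_zero _)

/-- Substitution of variables fixes the identity matrix. -/
theorem linSubstEntries_one_aux :
    Matrix.linSubstEntries γ (1 : Matrix (Fin w) (Fin w) (MvPolynomial σ k)) = 1 :=
  Matrix.map_one _ (map_zero _) (map_one _)

/-- Substitution of variables commutes with negation. -/
theorem linSubstEntries_neg_aux (M : Matrix (Fin w) (Fin w) (MvPolynomial σ k)) :
    Matrix.linSubstEntries γ (-M) = -Matrix.linSubstEntries γ M :=
  Matrix.map_neg _ (map_neg _) M

/-- Substitution of variables commutes with reindexing. -/
theorem linSubstEntries_submatrix_aux {m n : Type*} (A : Matrix m m (MvPolynomial σ k)) (r : n → m) :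
    Matrix.linSubstEntries γ (A.submatrix r r) = (Matrix.linSubstEntries γ A).submatrix r r := rfl

/-- Reindexing an invertible matrix along an equivalence. -/
theorem submatrix_equiv_mul_inv {m n : Type*} [Fintype m] [DecidableEq m] [Fintype n] [DecidableEq n]
    (e : m ≃ n) (g : GL m k) :
    (g : Matrix m m k).submatrix e.symm e.symm * ((g⁻¹ : GL m k) : Matrix m m k).submatrix e.symm e.symm = 1 := by
  rw [Matrix.submatrix_mul_equiv, ← Units.val_mul, mul_inv_cancel, Units.val_one, Matrix.submatrix_one_equiv]

/-- … and in the other order. -/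
theorem submatrix_equiv_inv_mul {m n : Type*} [Fintype m] [DecidableEq m] [Fintype n] [DecidableEq n]
    (e : m ≃ n) (g : GL m k) :
    ((g⁻¹ : GL m k) : Matrix m m k).submatrix e.symm e.symm * (g : Matrix m m k).submatrix e.symm e.symm = 1 := by
  rw [Matrix.submatrix_mul_equiv, ← Units.val_mul, inv_mul_cancel, Units.val_one, Matrix.submatrix_one_equiv]

/-- A `GL` element reindexed along an equivalence. -/
def glReindex {m n : Type*} [Fintype m] [DecidableEq m] [Fintype n] [DecidableEq n]
    (e : m ≃ n) (g : GL m k) : GL n k :=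
  ⟨(g : Matrix m m k).submatrix e.symm e.symm, ((g⁻¹ : GL m k) : Matrix m m k).submatrix e.symm e.symm,
    submatrix_equiv_mul_inv e g, submatrix_equiv_inv_mul e g⟩

end Aux

/-- A program of width `0` computes `0`. -/
theorem eval_eq_zero_of_width_zero (P : LayeredABP σ k L 0) : P.eval = 0 := by
  simp [eval, dotProduct]

end LayeredABP

/-- The zero polynomial has an (everything-)equivariant determinantal representation of size `1`. -/
theorem hasEquivariantDetRepr_zero_one [Fintype σ] [DecidableEq σ] {Γ : Subgroup (GL σ k)} :
    HasEquivariantDetRepr Γ (0 : MvPolynomial σ k) 1 := by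
  refine ⟨0, ⟨fun i j => by simp, by simp⟩, fun γ _ => ⟨1, 1, ?_⟩⟩
  rw [Matrix.linSubstEntries, Matrix.map_zero _ (map_zero _), Matrix.mul_zero, Matrix.zero_mul]

end Valiant

end

end Summit.ValiantsHypothesis.ValiantsHypothesis.Theorems.EquivariantDialLayers
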